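import Literature.Claims.NS.Lam2019
import Mathlib.Analysis.Calculus.BumpFunction.Normed
import HarnessLib

/-!
# C14 `Lam2019` (arXiv:1903.12098 v3, §8) — refuter's kernel record (cell `ns-claims`, D-0090)

Claim row C14, refuter `ns-claims-refuter-7`. The typed Steps 1, 3–6 of
`Literature.Claims.NS.Lam2019` are time-uniform a-priori bounds (open-strength, Euler included) and
are not decided here. What IS decidable is the printed INFERENCE leading to (8.19) p.41: from the
invariance of the signed integrals (8.17) («∫ξ dx = ∫max(ξ,0)dx + ∫min(ξ,0)dx, where the last sum is
finite and hence each of the integrals must be bounded … By the Archimedean property for two positive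
reals, ‖ω‖_{L¹(ℝ³)} < A*₀») — i.e. that the value of a signed integral controls the L¹ norm. The
referee's function-level retype of that inference (RETYPE.md §2 R#3) is the proposition negated
by `not_SignedIntegralBoundsL1` below (stated inline, no named fact); the witness is with the one-parameter family
`ξ_λ = λ · (φ(· − e) − φ(· + e))` (φ a smooth bump): `∫ ξ_λ = 0` for every `λ` while `∫ |ξ_λ| → ∞`.
(In the print's class the premise (8.17) is moreover the identity `0 = 0`:
`…Theorems.Lam2019Salvage.step2_invariance_holds`, p467544.)

WHAT THIS IS NOT: not a claim about the Navier–Stokes problem itself; not a claim about any author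
beyond the typed locator.
-/

open MeasureTheory

set_option linter.dupNamespace false

namespace Summit.NavierStokesRegularity.NavierStokesRegularity.Theorems.Lam2019

local notation "E3" => EuclideanSpace ℝ (Fin 3)

/-- The standard bump `φ` (Mathlib `ContDiffBump`, radii `1 < 2`) centred at the origin. -/
private noncomputable def bump : ContDiffBump (0 : E3) := ⟨1, 2, one_pos, one_lt_two⟩

/-- The shift vector `e = 5 e₁`. -/
private noncomputable def shift : E3 := EuclideanSpace.single 0 (5 : ℝ)

/-- An odd two-bump profile: `ψ(x) = φ(x − e) − φ(x + e)`. -/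
private noncomputable def ψ (x : E3) : ℝ := bump (x - shift) - bump (x + shift)

/-- `‖e‖ = 5`. -/
private lemma norm_shift : ‖shift‖ = 5 := by
  simp [shift]

/-- `ψ` is continuous. -/
private lemma ψ_continuous : Continuous ψ :=
  (bump.continuous.comp (continuous_id.sub continuous_const)).sub
    (bump.continuous.comp (continuous_id.add continuous_const))

/-- `ψ` is integrable. -/
private lemma ψ_integrable : Integrable ψ :=
  (bump.integrable.comp_sub_right shift).sub (bump.integrable.comp_add_right shift)

/-- `∫ ψ = 0` (translation invariance of the integral). -/
private lemma integral_ψ : ∫ x, ψ x = 0 := by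
  unfold ψ
  rw [integral_sub (bump.integrable.comp_sub_right shift) (bump.integrable.comp_add_right shift),
    integral_sub_right_eq_self (fun x => (bump : E3 → ℝ) x) shift,
    integral_add_right_eq_self (fun x => (bump : E3 → ℝ) x) shift, sub_self]

/-- `ψ(e) = 1`. -/
private lemma ψ_shift : ψ shift = 1 := by
  unfold ψ
  have h1 : (bump : E3 → ℝ) (shift - shift) = 1 := by
    apply bump.one_of_mem_closedBall
    simp [bump]
  have h2 : (bump : E3 → ℝ) (shift + shift) = 0 := by
    apply bump.zero_of_le_dist
    have : dist (shift + shift) (0 : E3) = 10 := by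
      rw [dist_zero_right, ← two_smul ℝ shift, norm_smul, norm_shift]; norm_num
    simp only [bump, this]; norm_num
  rw [h1, h2, sub_zero]

/-- The `L¹` norm of `ψ` is positive. -/
private lemma integral_abs_ψ_pos : 0 < ∫ x, |ψ x| := by
  have hint : Integrable (fun x => |ψ x|) := ψ_integrable.abs
  have h0 : 0 ≤ ∫ x, |ψ x| := integral_nonneg fun x => abs_nonneg (ψ x)
  rcases h0.lt_or_eq with h | h
  · exact h
  · exfalso
    have hae : (fun x => |ψ x|) =ᵐ[volume] 0 :=
      (integral_eq_zero_iff_of_nonneg (fun x => abs_nonneg (ψ x)) hint).1 h.symm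
    have hψ0 : ψ =ᵐ[volume] (fun _ => (0 : ℝ)) := by
      filter_upwards [hae] with x hx
      simpa using hx
    have : ψ = fun _ => (0 : ℝ) := (ψ_continuous.ae_eq_iff_eq volume continuous_const).1 hψ0
    have h1 := congrFun this shift
    rw [ψ_shift] at h1
    exact one_ne_zero h1

/-- **Refutes the function-level inference (8.18) ⇒ (8.19) of Lam 2019 p.41 (referee retype R#3:
«the value of the signed integral of an integrable scalar field on `ℝ³` bounds its `L¹` norm» — for
every prescribed value `c` of `∫ ξ` a bound `B` on `∫ |ξ|` valid for all integrable `ξ` with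
`∫ ξ = c`)** [refuted-substantive at function level]: a fixed value of the signed integral does not
bound the `L¹` norm. Witness: `ξ_λ = λ · ψ`, `ψ(x) = φ(x − e) − φ(x + e)` with `φ` a smooth bump and
`‖e‖ = 5`: `∫ ξ_λ = 0` for all `λ`, `∫ |ξ_λ| = |λ| ∫ |ψ|` unbounded. No repair at this level (the
premise carries no size information); the solution-level statement `Step3_vorticityL1` is an
open-strength a-priori bound, not decided here. [folklore] -/
theorem not_SignedIntegralBoundsL1 :
    ¬ (∀ c : ℝ, ∃ B : ℝ, ∀ ξ : E3 → ℝ, Integrable ξ → ∫ x, ξ x = c → ∫ x, |ξ x| ≤ B) := by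
  intro h
  obtain ⟨B, hB⟩ := h 0
  set I : ℝ := ∫ x, |ψ x| with hI
  have hIpos : 0 < I := integral_abs_ψ_pos
  -- the scaled profile `λ • ψ` with `λ = (|B| + 1) / I`
  set c : ℝ := (|B| + 1) / I with hc
  have hcpos : 0 < c := div_pos (by positivity) hIpos
  have hξ := hB (fun x => c * ψ x) (ψ_integrable.const_mul c)
    (by rw [integral_const_mul, integral_ψ, mul_zero])
  have hval : ∫ x, |c * ψ x| = c * I := by
    simp_rw [abs_mul, abs_of_pos hcpos]
    rw [integral_const_mul]
  rw [hval, hc, div_mul_cancel₀ _ hIpos.ne'] at hξ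
  linarith [le_abs_self B]

end Summit.NavierStokesRegularity.NavierStokesRegularity.Theorems.Lam2019
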